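import Literature.MathematicalPhysics.QuantumFieldTheory.QCDCalibratedSpecies
import Literature.MathematicalPhysics.QuantumLattice.WilsonFermionBlockAveraging
import HarnessLib

/-!
# Gauge-covariant block maps for lattice QCD and bounded renormalised insertions

Definition request `defn-GaugeCovariantBlockMap` (route `QuantumFields/QCD/GapBuysCauchyRate`,
informal cruxes `OneStepSymanzik` = stmt-QuantumFields-11540 and `CalibratedClustering` =
stmt-QuantumFields-11541), on top of `QCDOS.lean` (`GaugeConfig 4 S SU(3)`, the quark Grassmann
algebra `FermiAlg N_f S`, `qcdTorusExpect`, `QCDScheme`, `smearedInsertion`, `QCDLatticeObservable`),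
`QCDCalibratedSpecies.lean` (`QCDRegularisation.scheme`, `CalibratedSpeciesFamily`) and the tree's
gauge-covariant block averaging of Wilson fermions (`QuantumLattice/WilsonFermionBlockAveraging`:
`transport`, `torusBlockOf`, `torusBlockCorner`, `blockTransporter`, `gaugeRotation`,
`fermionBlockAvg`, `fermionBlockAvgBar` and their gauge covariance).

## Content

1. **Linear substitutions of quark generators** (`quarkSubstLin`, `quarkSubst`): the `ℂ`-algebra
   homomorphism `FermiAlg N_f S →ₐ FermiAlg N_f T` sending `ψ_{f,p} ↦ Σ_q A_{pq} ψ_{f,q}` and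
   `ψ̄_{f,p} ↦ Σ_q ψ̄_{f,q} Ā_{qp}` for a pair of matrices `(A, Ā)` on (site × colour × spin)
   (`QuarkPos`), flavour carried along (Berezin 1966, Ch. I §3: homomorphisms of Grassmann algebras
   are induced by linear maps of the generators; Mathlib `ExteriorAlgebra.map`); functoriality
   `quarkSubst_comp`, `quarkSubst_one`, and the action on generators `quarkSubst_q`, `quarkSubst_qbar`.
   Two instances: the **lattice gauge transformation of the quark variables of a torus**
   `torusQuarkGauge g` (`ψ ↦ 𝒢(g)ψ`, `ψ̄ ↦ ψ̄𝒢(g)⁻¹`, the torus twin of `QCDOS.fermiGaugeAct`;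
   Montvay–Münster §5.1.1 (5.3)–(5.5)) with the joint gauge invariance predicate
   `IsQuarkGaugeInvariant A` for Grassmann-valued functions `A` of the torus gauge field, and the
   quark pull-back of a block map (below).
2. **`GaugeCovariantBlockMap M S`** — an ADMISSIBLE BLOCK-AVERAGING MAP from lattice QCD
   configurations on the torus of side `M·S` (fine) to the torus of side `S` (coarse), blocks of
   `M⁴` sites `B(y) = {x | ⌊x/M⌋ = y}` (`torusBlockOf M S`) represented by the sites `M y`
   (`torusBlockCorner M S`): DATA a link map `link : (fine gauge fields) → (coarse gauge fields)` and
   the covariant averaging matrices `avg U = Q(U)` (coarse × fine), `avgBar U = Q̄(U)` (fine × coarse)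
   of the quark generators, `ψ_B(y) = Σ_{x ∈ B(y)} Q(U)_{y x} ψ(x)`, `ψ̄_B(y) = Σ_x ψ̄(x) Q̄(U)_{x y}`;
   PROPERTIES: `link` commutes with lattice gauge transformations `g ↦ g ∘ (y ↦ M y)`
   (`link (U^g) = (link U)^{g ∘ corner}`), `Q(U^g) = 𝒢'(g ∘ corner) Q(U) 𝒢(g)⁻¹`,
   `Q̄(U^g) = 𝒢(g) Q̄(U) 𝒢'(g ∘ corner)⁻¹`, and `Q(U)_{y x} = 0 = Q̄(U)_{x y}` unless `x ∈ B(y)`. This is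
   the class Bałaban has in mind when he writes that instead of his averaging (0.4)/(0.12) of [I]
   "we may take any averaging operation satisfying several general properties" (CMP 119 (1988)
   p. 243); the request asked for exactly this latitude ("any fixed covariant choice is acceptable
   as long as it commutes with lattice gauge transformations `g ↦ g ∘ (coarse site map)`").
   In the namespace: the **quark pull-back** `B.quarkPullback N_f U = quarkSubst (Q U) (Q̄ U)`, the
   **pull-back of a coarse observable** `B.pullback A = (U ↦ (quark pull-back) (A (link U)))`
   ("`A ∘ B`"), its gauge invariance `pullback_isQuarkGaugeInvariant` (gauge-invariant coarse
   observables pull back to gauge-invariant fine observables — the point of covariance), and the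
   **push-forward functional** `B.expect β m A = ⟨A ∘ B⟩` = `qcdTorusExpect β (M·S) m (B.pullback A)`,
   i.e. the image `B_*μ` of the fine lattice-QCD functional evaluated on coarse observables.
3. **The canonical inhabitant `GaugeCovariantBlockMap.central M S`**: coarse link
   `(y, μ) ↦ U(My, μ) U(My + e_μ, μ) ⋯ U(My + (M-1)e_μ, μ)`, the parallel transporter along the
   straight line from the representative `My` of `B(y)` to the representative `M(y + e_μ)` of the
   neighbouring block (the tree's reading of Bałaban's block link variable in the block axial gauge,
   `BalabanRG.axialBlockHolonomy`, CMP 95 (1984) (1.4)–(1.6); Dimock 2022 §2 averages these straight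
   transporters over `x ∈ B(y)` in the abelian case), and the Bałaban–O'Carroll–Schor / Dimock
   covariant quark averages `Q(U)_{(y,a,α),(x,b,β)} = M⁻⁴ [x ∈ B(y)] ρ(U(Γ_{My,x}))_{ab} δ_{αβ}`
   (tree `fermionBlockAvg`, transport along the fixed coordinate-ordered path from `My` to `x`;
   BOS 1989 (1.1); Dimock 2022 §2 "(Q(A)Ψ)(y) = L⁻³ Σ_{x∈B(y)} e^{ieA(Γ(y,x))} Ψ(x) … parallel
   translate to the center of the cube before averaging, so that gauge covariance is preserved").
   Gauge covariance of the straight transporter is `transport_gaugeTransform` plus the endpoint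
   computation `pathEnd_torusBlockCorner_replicate` (`torusBlockCorner` is additive,
   `torusBlockCorner_add`, `torusBlockCorner_single`).
4. **Ladders and blocked lattice `n`-point functions.** `QCDScheme.IsBlockLadder M sch`: the
   spacings are exactly `M`-adic, `a_k = M a_{k+1}` (`IsBlockLadder.a_eq`: `a_k = a_0 M^{-k}`;
   `IsBlockLadder.one_lt`; non-vacuity `QCDScheme.triadic`, `isBlockLadder_triadic`), so that the
   step-`(k+1)` lattice is the `M`-fold refinement of the step-`k` lattice and one RG octave is one block
   map. The tori are NOT nested (`side (k+1) = M · side k` would freeze the physical volume, against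
   `a_k L_k → ∞`): comparisons are made on a common torus, coarse side `2S'+1`, fine side `M(2S'+1)`.
   `smearedInsertionOn sch k S'` is the step-`k` smeared species field on the torus of side `2S'+1`
   (= `smearedInsertion` at `S' = L_k`), `latticeSchwingerOn sch k S' n σ f = ⟨∏ᵢ Φ_k^{σᵢ}(fᵢ)⟩` the
   step-`k` functional on that torus (= `qcdLatticeSchwinger` at `S' = L_k`, `latticeSchwingerOn_self`),
   and `blockedLatticeSchwinger sch k S' B n σ f = ⟨(∏ᵢ Φ_k^{σᵢ}(fᵢ)) ∘ B⟩_{k+1}` its blocked successor: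
   the same coarse observable pulled back along `B : GaugeCovariantBlockMap M (2S'+1)` and integrated
   against the lattice QCD functional with the step-`(k+1)` couplings `β_{k+1}`, `m_f(k+1)` on the fine
   torus. Their difference is the route's ONE-OCTAVE INCREMENT `S_{k+1}(F) - S_k(F)` in the volume
   `(2S'+1)a_k`, up to the blocked-vs-fine species mismatch and the finite-volume bookkeeping the route
   defers to the volume-uniformity of its gap clause.
5. **Bounded renormalised insertions** (`IsBoundedInsertion d reg z shift O`). For a
   mass-independent regularisation `reg`, species renormalisations `z, shift` (as functions of the
   renormalised mass tuple `m`, cf. `CalibratedSpeciesFamily`), and a family `O k` of gauge-invariant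
   local lattice QCD densities (`QCDLatticeObservable N_f R`: bounded link functions × quark
   polynomials in a fixed box, placed at `x` by `onTorus`), the predicate "the truncated insertion of
   `O_k(x)` into the renormalised smeared correlators is bounded by `C a_k^d` at separated points,
   uniformly in `k`, in the volume and locally uniformly in the masses": for all `n`, species strings
   `σ`, real test functions `fᵢ` with pairwise SEPARATED supports (`AreSupportSeparated`), every
   compact set `K` of positive mass tuples and every `δ > 0` there is `C` with
   `‖⟨Φ_k^{σ₁}(f₁) ⋯ Φ_k^{σₙ}(fₙ) ; O_k(x)⟩_conn‖ ≤ C · a_k^d` for all large `k` (`∃ C, ∀ᶠ k`, as in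
   `HasLatticeMassGap`), all `m ∈ K`, all tori of side
   `2S'+1 ≥ 2L_k+1` (the smeared fields summed over the box of THAT torus, `smearedInsertionOn`; the
   truncated expectation `insertionCorr` = `⟨(∏Φ) O⟩ - ⟨∏Φ⟩⟨O⟩` under `qcdTorusExpect` at `β_k`,
   `m_f(k)`), and all lattice points `x` of the box at physical distance `≥ δ` from every `supp fᵢ`
   (`δ ≤ dist (a_k x) y` for `y ∈ tsupport fᵢ`). Here `d` is the canonical (power-counting) dimension
   of the dimensionless lattice densities `O_k`: at tree level `O_k(x) ≈ a_k^d O^{phys}(a_k x)`, and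
   renormalised composite operators of dimension `d` keep this scaling up to logarithms absorbed in
   the family `O_k` (Symanzik's local effective Lagrangian; Montvay–Münster §5.3 after (5.219):
   coefficients of higher-dimension operators are "proportional to positive powers of the lattice
   spacing", improvement removes `O(a)`); the smeared fields `Φ_k^s(f) = z_s(k) a_k⁴ Σ_x f(a_k x)(O_s(x)
   - shift_s(k))` are `O(1)`. So a Symanzik remainder `Σ_x [O_{6,k}(x) + O_{5,k}(x)]` of the action with
   `IsBoundedInsertion 6`, `5` has response `O(a_k²)`, `O(a_k)` after the `a_k⁻⁴`-fold site sum over a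
   physical region — the dimension counting the cruxes rely on. `insertionCorr_one`,
   `isBoundedInsertion_one` (the unit density has vanishing truncated insertions: non-vacuity).

## Design choices and faithfulness flags

* Blocks are labelled by the representatives `M y` ("corners") exactly as in the tree
  (`BalabanRG.blockBase`, `torusBlockOf`/`torusBlockCorner`, `BlockFermionRG`); Bałaban, Gawędzki–
  Kupiainen and Dimock centre their blocks (`L` odd, Dimock 2013 §2.1 "B(y) … centered on y … we
  assume L is odd"). On the torus the two conventions differ by the fine translation
  `x ↦ x + (⌊M/2⌋, …, ⌊M/2⌋)`, a symmetry of the lattice QCD functional, so all covariance and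
  locality statements and all bounds are convention independent.
* The structure imposes gauge covariance and the block support of the quark averages, NOT:
  hypercubic (or translation) covariance, nor that `link U (y, μ)` reads only the links of
  `B(y) ∪ B(y + e_μ)` — both hold for `central` by construction (straight lines and in-block paths;
  the coordinate-ordered paths are covariant under translations and reflections, under axis
  permutations only after symmetrising the path system, cf. Bałaban CMP 119 (1988) p. 247 "we average
  over the Euclidean transformations of the lattice, leaving the center of the block invariant") but
  would need the hypercubic action on `GaugeConfig`/`FermiAlg`, which the tree does not have. A
  consumer wanting them states them as hypotheses on `B`.
* Bałaban's own block link is a NON-LINEAR average of the `M⁴` transporters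
  `U(Γ_{y,x}) U(x → x + M e_μ) U(Γ_{y',x'})⁻¹` defined through the exponential map on small fields
  (CMP 98 (1985); CMP 119 (1988) (0.1) with (0.4)/(0.12) of [I]); `central` keeps its central term
  (`x = My`), which is what the average reduces to in the block axial gauge at tree level and is a
  total function with values in `SU(3)` (no projection needed). Any other admissible choice is another
  term of type `GaugeCovariantBlockMap M S`.
* Normalisation of the quark average: the arithmetic-mean weight `M⁻⁴` of the tree (BOS's `Q`); no
  canonical-dimension factor `M^{3/2}` is included (it is a finite species renormalisation, absorbed by
  `z_s` — the "blocked-vs-fine species mismatch" of the request).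
* `B.expect` is stated for an arbitrary coarse side `S`; `blockedLatticeSchwinger` evaluates the
  step-`(k+1)` COUPLINGS on the fine torus of side `M(2S'+1)` over an arbitrary coarse torus `2S'+1`, not
  on the scheme's own step-`(k+1)` torus (no casts between `GaugeConfig` types are built in; the
  scheme's tori cannot be exactly nested, see `IsBlockLadder`).
* `IsBoundedInsertion`: the constant may depend on `(n, σ, f, K, δ)` but not on `k`, `m ∈ K`, the
  torus or the point; distances are Euclidean distances in `ℝ⁴` of `a_k x`, `x` in the fundamental box
  of the torus, from the supports (wrap-around proximity across the periodic boundary is not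
  excluded; it is eventually immaterial since `a_k L_k → ∞`); `O : ℕ → QCDLatticeObservable N_f R` has a
  fixed quark box `R` but the uniform boundedness of the link supports in `k` ("within `O(1)` lattice
  units of `x`") is left to the user as a side condition. NOT here: any claim that honest lattice QCD
  satisfies `IsBoundedInsertion` for some family, or that a blocked QCD action has a convergent local
  representation (the cruxes themselves).

## Mathlib status

Mathlib (pinned) has `ExteriorAlgebra.map` (functorial: `map_comp_map`, `map_id`, `map_apply_ι`),
`LinearMap.pi`/`proj`, matrices; no lattice gauge theory, block-spin maps or Grassmann field
substitutions. Everything lattice-side is the tree's (`QCDOS`, `QCDCalibratedSpecies`,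
`WilsonFermionBlockAveraging`, `ConstructiveQFTWave0`).

## References

* T. Bałaban, *Convergent renormalization expansions for lattice gauge theories*, CMP 119 (1988)
  243–285 (held `paper:doi-10-1007-bf01217741`): p. 243 (0.1) `(Tρ)(V) = ∫ dU δ(ŪV⁻¹) ρ(U)` and "we may
  take any averaging operation satisfying several general properties, analogous to the properties
  (0.5)–(0.9) [I]"; p. 247 (averaging over Euclidean transformations of the block). [Balaban1988Convergent]
* T. Bałaban, CMP 95 (1984) 17, §1 (1.4)–(1.7) (block link variables, straight-line transporters,
  gauge covariance; as cited by the tree's `BalabanRG`/`WilsonFermionBlockAveraging`). [Balaban1984Propagators]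
* T. Bałaban, CMP 109 (1987) 249, (0.1)–(0.3) (the renormalization transformation of 4-d lattice
  gauge theories). [Balaban1987RG1]
* T. Bałaban, M. O'Carroll, R. Schor, CMP 122 (1989) 233, (1.1) p. 234 (`Q` "the arithmetic averaging
  operator over a block"; held `paper:doi-10-1007-bf01257414`). [BalabanOcarrollSchor1989]
* J. Dimock, J. Math. Phys. 63 (2022) 042305, §2 p. 4 (covariant fermion average `Q(A)`, averaged gauge
  field on coarse bonds, "This also preserves gauge covariance"; held `paper:arxiv-2204.07201`). [Dimock2022QED3]
* J. Dimock, Rev. Math. Phys. 25 (2013) 1330010, §2.1 (block averaging `(Qf)(y) = L⁻³ Σ_{x∈B(y)} f(x)`,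
  `L` odd, centred blocks; held `paper:arxiv-1108.1335`). [Dimock2013]
* K. Gawędzki, A. Kupiainen, CMP 99 (1985) 197 (block-spin RG of an asymptotically free lattice
  model). [GawedzkiKupiainenMasslessLattice1985]
* K. Symanzik, Nucl. Phys. B 226 (1983) 187 (local effective Lagrangian: cutoff effects as insertions
  of higher-dimension local operators). [Symanzik1983]
* I. Montvay, G. Münster, *Quantum Fields on a Lattice* (1994), §5.1.1 (5.3)–(5.5) (gauge
  transformation of quark fields), §5.3 (5.218)–(5.219) and sequel (operator mixing by dimension,
  positive powers of `a` for higher-dimension operators). [MontvayMunster1994]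
* J. Glimm, A. Jaffe, *Quantum Physics* (1987), §6.1 (truncated expectations). [GlimmJaffe1987]
* F. A. Berezin, *The Method of Second Quantization* (1966), Ch. I §3. [Berezin1966]
-/

open scoped SchwartzMap
open MeasureTheory Filter Topology
open Literature.MathematicalPhysics.AQFT Literature.Probability.LatticeModels
  Literature.MathematicalPhysics.QuantumLattice

noncomputable section

namespace Literature.MathematicalPhysics.QuantumFieldTheory

local notation "𝔾" => Matrix.specialUnitaryGroup (Fin 3) ℂ

/-! ### Linear substitutions of the quark generators -/

section Subst

/-- The (site × colour × spin) index of the quark variables of the torus of side `S`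
(`QuarkVar N_f S = Fin N_f × QuarkPos S`). [cite: MontvayMunster1994, §5.1] -/
abbrev QuarkPos (S : ℕ) : Type := TorusSite 4 S × Fin 3 × Fin 4

variable {Nf S T V : ℕ} [NeZero S] [NeZero T] [NeZero V]

/-- The linear map of generator coefficients behind `quarkSubst`: a coefficient vector `c` of the
quark generators of the torus of side `S` is sent to the vector on the torus of side `T` with
`ψ`-components `(Lc)_{f,q} = Σ_p A_{pq} c_{f,p}` and `ψ̄`-components `(Lc)‾_{f,q} = Σ_p Ā_{qp} c̄_{f,p}`, so
that the basis vector of `ψ_{f,p}` goes to `Σ_q A_{pq} e(ψ_{f,q})` and that of `ψ̄_{f,p}` to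
`Σ_q Ā_{qp} e(ψ̄_{f,q})`. [cite: Berezin1966, Ch. I §3] -/
def quarkSubstLin (A : Matrix (QuarkPos S) (QuarkPos T) ℂ) (Ab : Matrix (QuarkPos T) (QuarkPos S) ℂ) :
    (FermiIdx Nf S ⊕ₗ FermiIdx Nf S → ℂ) →ₗ[ℂ] (FermiIdx Nf T ⊕ₗ FermiIdx Nf T → ℂ) :=
  LinearMap.pi fun w =>
    match ofLex w with
    | Sum.inl i =>
        ∑ p : QuarkPos S, Ab (quarkEquiv.symm i).2 p •
          LinearMap.proj (toLex (Sum.inl (quarkEquiv ((quarkEquiv.symm i).1, p))))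
    | Sum.inr i =>
        ∑ p : QuarkPos S, A p (quarkEquiv.symm i).2 •
          LinearMap.proj (toLex (Sum.inr (quarkEquiv ((quarkEquiv.symm i).1, p))))

/-- **Linear substitution of quark generators**: the `ℂ`-algebra homomorphism
`FermiAlg N_f S →ₐ FermiAlg N_f T` with `ψ_{f,p} ↦ Σ_q A_{pq} ψ_{f,q}` and `ψ̄_{f,p} ↦ Σ_q ψ̄_{f,q} Ā_{qp}`
(flavour unchanged) — the homomorphism of Grassmann algebras induced by a linear map of the
generators (Mathlib `ExteriorAlgebra.map`). Lattice gauge transformations of the quark fields and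
the quark part of a block-averaging map are of this form. [cite: Berezin1966, Ch. I §3] -/
def quarkSubst (A : Matrix (QuarkPos S) (QuarkPos T) ℂ) (Ab : Matrix (QuarkPos T) (QuarkPos S) ℂ) :
    FermiAlg Nf S →ₐ[ℂ] FermiAlg Nf T :=
  ExteriorAlgebra.map (quarkSubstLin A Ab)

/-- The `ψ̄`-components of a substituted coefficient vector. [folklore] -/
theorem quarkSubstLin_apply_inl (A : Matrix (QuarkPos S) (QuarkPos T) ℂ)
    (Ab : Matrix (QuarkPos T) (QuarkPos S) ℂ) (c : FermiIdx Nf S ⊕ₗ FermiIdx Nf S → ℂ)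
    (f : Fin Nf) (q : QuarkPos T) :
    quarkSubstLin A Ab c (toLex (Sum.inl (quarkEquiv (f, q)))) =
      ∑ p : QuarkPos S, Ab q p * c (toLex (Sum.inl (quarkEquiv (f, p)))) := by
  simp [quarkSubstLin, LinearMap.pi_apply]

/-- The `ψ`-components of a substituted coefficient vector. [folklore] -/
theorem quarkSubstLin_apply_inr (A : Matrix (QuarkPos S) (QuarkPos T) ℂ)
    (Ab : Matrix (QuarkPos T) (QuarkPos S) ℂ) (c : FermiIdx Nf S ⊕ₗ FermiIdx Nf S → ℂ)
    (f : Fin Nf) (q : QuarkPos T) :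
    quarkSubstLin A Ab c (toLex (Sum.inr (quarkEquiv (f, q)))) =
      ∑ p : QuarkPos S, A p q * c (toLex (Sum.inr (quarkEquiv (f, p)))) := by
  simp [quarkSubstLin, LinearMap.pi_apply]

/-- Two coefficient vectors on the torus of side `T` agree iff they agree on all `ψ̄_{f,q}` and all
`ψ_{f,q}` components. [folklore] -/
theorem fermiCoeff_ext {c c' : FermiIdx Nf T ⊕ₗ FermiIdx Nf T → ℂ}
    (hl : ∀ f q, c (toLex (Sum.inl (quarkEquiv (f, q)))) = c' (toLex (Sum.inl (quarkEquiv (f, q)))))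
    (hr : ∀ f q, c (toLex (Sum.inr (quarkEquiv (f, q)))) = c' (toLex (Sum.inr (quarkEquiv (f, q))))) :
    c = c' := by
  funext w
  refine @Lex.rec _ (fun w => c w = c' w) (fun s => ?_) w
  rcases s with i | i
  · obtain ⟨⟨f, q⟩, rfl⟩ := quarkEquiv.surjective i
    exact hl f q
  · obtain ⟨⟨f, q⟩, rfl⟩ := quarkEquiv.surjective i
    exact hr f q

/-- **Functoriality**: substituting along `(A', Ā')` and then along `(A, Ā)` is substituting along
`(A'A, ĀĀ')` (on coefficient vectors). [folklore] -/
theorem quarkSubstLin_comp (A : Matrix (QuarkPos T) (QuarkPos V) ℂ) (Ab : Matrix (QuarkPos V) (QuarkPos T) ℂ)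
    (A' : Matrix (QuarkPos S) (QuarkPos T) ℂ) (Ab' : Matrix (QuarkPos T) (QuarkPos S) ℂ) :
    quarkSubstLin (Nf := Nf) A Ab ∘ₗ quarkSubstLin A' Ab' = quarkSubstLin (A' * A) (Ab * Ab') := by
  refine LinearMap.ext fun c => fermiCoeff_ext (fun f q => ?_) (fun f q => ?_)
  · simp only [LinearMap.coe_comp, Function.comp_apply, quarkSubstLin_apply_inl, Matrix.mul_apply,
      Finset.mul_sum, Finset.sum_mul]
    rw [Finset.sum_comm]
    refine Finset.sum_congr rfl fun p _ => Finset.sum_congr rfl fun r _ => ?_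
    ring
  · simp only [LinearMap.coe_comp, Function.comp_apply, quarkSubstLin_apply_inr, Matrix.mul_apply,
      Finset.mul_sum, Finset.sum_mul]
    rw [Finset.sum_comm]
    refine Finset.sum_congr rfl fun p _ => Finset.sum_congr rfl fun r _ => ?_
    ring

/-- The identity substitution is the identity on coefficient vectors. [folklore] -/
theorem quarkSubstLin_one :
    quarkSubstLin (Nf := Nf) (1 : Matrix (QuarkPos S) (QuarkPos S) ℂ) 1 = LinearMap.id := by
  refine LinearMap.ext fun c => fermiCoeff_ext (fun f q => ?_) (fun f q => ?_)
  · simp only [quarkSubstLin_apply_inl, LinearMap.id_coe, id_eq, Matrix.one_apply, ite_mul, one_mul,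
      zero_mul, Finset.sum_ite_eq, Finset.mem_univ, if_true]
  · simp only [quarkSubstLin_apply_inr, LinearMap.id_coe, id_eq, Matrix.one_apply, ite_mul, one_mul,
      zero_mul, Finset.sum_ite_eq', Finset.mem_univ, if_true]

/-- **Functoriality of `quarkSubst`**: `quarkSubst A Ā ∘ quarkSubst A' Ā' = quarkSubst (A'A) (ĀĀ')`. [folklore] -/
theorem quarkSubst_comp (A : Matrix (QuarkPos T) (QuarkPos V) ℂ) (Ab : Matrix (QuarkPos V) (QuarkPos T) ℂ)
    (A' : Matrix (QuarkPos S) (QuarkPos T) ℂ) (Ab' : Matrix (QuarkPos T) (QuarkPos S) ℂ) :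
    (quarkSubst (Nf := Nf) A Ab).comp (quarkSubst A' Ab') = quarkSubst (A' * A) (Ab * Ab') := by
  rw [quarkSubst, quarkSubst, ExteriorAlgebra.map_comp_map, quarkSubstLin_comp]
  rfl

/-- The identity substitution is the identity homomorphism. [folklore] -/
theorem quarkSubst_one :
    quarkSubst (Nf := Nf) (1 : Matrix (QuarkPos S) (QuarkPos S) ℂ) 1 = AlgHom.id ℂ _ := by
  rw [quarkSubst, quarkSubstLin_one, ExteriorAlgebra.map_id]

/-- The basis vector of `ψ_{f,p}` is sent to `Σ_q A_{pq} e(ψ_{f,q})`. [folklore] -/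
theorem quarkSubstLin_single_inr (A : Matrix (QuarkPos S) (QuarkPos T) ℂ)
    (Ab : Matrix (QuarkPos T) (QuarkPos S) ℂ) (f : Fin Nf) (p : QuarkPos S) :
    quarkSubstLin A Ab (Pi.single (toLex (Sum.inr (quarkEquiv (f, p)))) 1) =
      ∑ q : QuarkPos T, A p q • (Pi.single (toLex (Sum.inr (quarkEquiv (f, q)))) (1 : ℂ) :
        FermiIdx Nf T ⊕ₗ FermiIdx Nf T → ℂ) := by
  refine fermiCoeff_ext (fun f' q => ?_) (fun f' q => ?_)
  · simp [quarkSubstLin_apply_inl, Finset.sum_apply]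
  · simp only [quarkSubstLin_apply_inr, Finset.sum_apply, Pi.smul_apply, Pi.single_apply,
      Sum.inr.injEq, EmbeddingLike.apply_eq_iff_eq, Prod.mk.injEq, smul_eq_mul, mul_ite, mul_one,
      mul_zero]
    by_cases hf : f' = f
    · subst hf
      simp only [true_and, Finset.sum_ite_eq', Finset.mem_univ, if_true]
      rw [Finset.sum_ite_eq]
      simp
    · simp [hf]

/-- The basis vector of `ψ̄_{f,p}` is sent to `Σ_q Ā_{qp} e(ψ̄_{f,q})`. [folklore] -/
theorem quarkSubstLin_single_inl (A : Matrix (QuarkPos S) (QuarkPos T) ℂ)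
    (Ab : Matrix (QuarkPos T) (QuarkPos S) ℂ) (f : Fin Nf) (p : QuarkPos S) :
    quarkSubstLin A Ab (Pi.single (toLex (Sum.inl (quarkEquiv (f, p)))) 1) =
      ∑ q : QuarkPos T, Ab q p • (Pi.single (toLex (Sum.inl (quarkEquiv (f, q)))) (1 : ℂ) :
        FermiIdx Nf T ⊕ₗ FermiIdx Nf T → ℂ) := by
  refine fermiCoeff_ext (fun f' q => ?_) (fun f' q => ?_)
  · simp only [quarkSubstLin_apply_inl, Finset.sum_apply, Pi.smul_apply, Pi.single_apply,
      Sum.inl.injEq, EmbeddingLike.apply_eq_iff_eq, Prod.mk.injEq, smul_eq_mul, mul_ite, mul_one,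
      mul_zero]
    by_cases hf : f' = f
    · subst hf
      simp only [true_and, Finset.sum_ite_eq', Finset.mem_univ, if_true]
      rw [Finset.sum_ite_eq]
      simp
    · simp [hf]
  · simp [quarkSubstLin_apply_inr, Finset.sum_apply]

/-- **Action on the generators `ψ`**: `quarkSubst A Ā (ψ_{f,p}) = Σ_q A_{pq} ψ_{f,q}`. [cite: Berezin1966, Ch. I §3] -/
theorem quarkSubst_q (A : Matrix (QuarkPos S) (QuarkPos T) ℂ) (Ab : Matrix (QuarkPos T) (QuarkPos S) ℂ)
    (f : Fin Nf) (p : QuarkPos S) :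
    quarkSubst A Ab (q (f, p)) = ∑ r : QuarkPos T, A p r • q (f, r) := by
  simp only [quarkSubst, q, psi, GrassmannAlgebra.gen, ExteriorAlgebra.map_apply_ι,
    quarkSubstLin_single_inr, map_sum, map_smul]

/-- **Action on the generators `ψ̄`**: `quarkSubst A Ā (ψ̄_{f,p}) = Σ_q Ā_{qp} ψ̄_{f,q}`. [cite: Berezin1966, Ch. I §3] -/
theorem quarkSubst_qbar (A : Matrix (QuarkPos S) (QuarkPos T) ℂ) (Ab : Matrix (QuarkPos T) (QuarkPos S) ℂ)
    (f : Fin Nf) (p : QuarkPos S) :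
    quarkSubst A Ab (qbar (f, p)) = ∑ r : QuarkPos T, Ab r p • qbar (f, r) := by
  simp only [quarkSubst, qbar, psiBar, GrassmannAlgebra.gen, ExteriorAlgebra.map_apply_ι,
    quarkSubstLin_single_inl, map_sum, map_smul]

/-! ### Lattice gauge transformations of the quark variables of a torus -/

/-- **The lattice gauge transformation `g : (ℤ/Sℤ)⁴ → SU(3)` on the quark Grassmann algebra of the
torus**: the algebra automorphism with `ψ(x) ↦ g(x)ψ(x)`, `ψ̄(x) ↦ ψ̄(x)g(x)⁻¹` on colour indices
(`quarkSubst` along the gauge rotation matrices `𝒢(g)`, `𝒢(g⁻¹)` of the tree; the torus twin of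
`QCDOS.fermiGaugeAct`, same index placement). [cite: MontvayMunster1994, §5.1.1 (5.3)–(5.5)] -/
def torusQuarkGauge (g : TorusSite 4 S → 𝔾) : FermiAlg Nf S →ₐ[ℂ] FermiAlg Nf S :=
  quarkSubst (gaugeRotation (fundamentalRep (Fin 3)) (Fin 4) g)
    (gaugeRotation (fundamentalRep (Fin 3)) (Fin 4) g⁻¹)

/-- The trivial gauge transformation acts as the identity. [folklore] -/
@[simp] theorem torusQuarkGauge_one : torusQuarkGauge (Nf := Nf) (1 : TorusSite 4 S → 𝔾) = AlgHom.id ℂ _ := by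
  rw [torusQuarkGauge, inv_one, gaugeRotation_one, quarkSubst_one]

/-- Gauge transformations compose CONTRAVARIANTLY, `𝒯(g) ∘ 𝒯(h) = 𝒯(hg)`: substitutions of
generators form a right action (`𝒯(h)` sends `ψ` to `𝒢(h)ψ`, whose generators `𝒯(g)` then rotates). [folklore] -/
theorem torusQuarkGauge_comp (g h : TorusSite 4 S → 𝔾) :
    (torusQuarkGauge (Nf := Nf) g).comp (torusQuarkGauge h) = torusQuarkGauge (h * g) := by
  rw [torusQuarkGauge, torusQuarkGauge, torusQuarkGauge, quarkSubst_comp, gaugeRotation_mul,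
    gaugeRotation_mul, mul_inv_rev]

/-- **Joint gauge invariance** of a Grassmann-valued function of the torus gauge field (a lattice QCD
observable on the torus of side `S`): `𝒯(g) (A(U^g)) = A(U)` for all lattice gauge transformations `g`
— invariance under `U ↦ U^g` on links together with `ψ ↦ gψ`, `ψ̄ ↦ ψ̄g⁻¹` (the torus form of the
invariance built into `QCDLatticeObservable`). [cite: OsterwalderSeiler1978, §2] -/
def IsQuarkGaugeInvariant (A : GaugeConfig 4 S 𝔾 → FermiAlg Nf S) : Prop :=
  ∀ (g : TorusSite 4 S → 𝔾) (U : GaugeConfig 4 S 𝔾), torusQuarkGauge g (A (gaugeTransform g U)) = A U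

/-- Constant observables are jointly gauge invariant. [folklore] -/
theorem isQuarkGaugeInvariant_const (a : ℂ) :
    IsQuarkGaugeInvariant (S := S) (fun _ => algebraMap ℂ (FermiAlg Nf S) a) :=
  fun g _ => AlgHom.commutes (torusQuarkGauge g) a

/-- Products of jointly gauge-invariant observables are jointly gauge invariant. [folklore] -/
theorem IsQuarkGaugeInvariant.mul {A A' : GaugeConfig 4 S 𝔾 → FermiAlg Nf S} (hA : IsQuarkGaugeInvariant A)
    (hA' : IsQuarkGaugeInvariant A') : IsQuarkGaugeInvariant fun U => A U * A' U :=
  fun g U => by rw [map_mul, hA g U, hA' g U]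

/-- Sums of jointly gauge-invariant observables are jointly gauge invariant. [folklore] -/
theorem IsQuarkGaugeInvariant.add {A A' : GaugeConfig 4 S 𝔾 → FermiAlg Nf S} (hA : IsQuarkGaugeInvariant A)
    (hA' : IsQuarkGaugeInvariant A') : IsQuarkGaugeInvariant fun U => A U + A' U :=
  fun g U => by rw [map_add, hA g U, hA' g U]

/-- Scalar multiples of jointly gauge-invariant observables are jointly gauge invariant. [folklore] -/
theorem IsQuarkGaugeInvariant.smul {A : GaugeConfig 4 S 𝔾 → FermiAlg Nf S} (hA : IsQuarkGaugeInvariant A)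
    (a : ℂ) : IsQuarkGaugeInvariant fun U => a • A U :=
  fun g U => by rw [map_smul, hA g U]

end Subst

/-! ### Block geometry: the representatives `M y` and straight transporters -/

section Corner

variable {d : ℕ} (M S : ℕ) [NeZero S]

omit [NeZero S] in
/-- `M (n mod S) ≡ M n (mod M S)`. [folklore] -/
theorem natCast_mul_mod_eq (n : ℕ) : ((M * (n % S) : ℕ) : ZMod (M * S)) = ((M * n : ℕ) : ZMod (M * S)) := by
  rw [← Nat.mul_mod_mul_left, ZMod.natCast_mod]

/-- The block representative map `y ↦ M y` is additive on the torus. [folklore] -/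
theorem torusBlockCorner_add (y y' : TorusSite d S) :
    torusBlockCorner M S (y + y') = torusBlockCorner M S y + torusBlockCorner M S y' := by
  funext i
  simp only [torusBlockCorner, Pi.add_apply, ZMod.val_add, natCast_mul_mod_eq, mul_add, Nat.cast_add]

omit [NeZero S] in
/-- The representative of the unit vector `e_μ` of the coarse torus is `M e_μ`. [folklore] -/
theorem torusBlockCorner_single (μ : Fin d) :
    torusBlockCorner M S (Pi.single μ 1) = Pi.single μ (M : ZMod (M * S)) := by
  funext i
  by_cases h : i = μ
  · subst h
    simp only [torusBlockCorner, Pi.single_eq_same, ZMod.val_one_eq_one_mod, natCast_mul_mod_eq, mul_one]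
  · simp [torusBlockCorner, h]

/-- The straight path of `M` steps in direction `μ` from the representative `M y` of the block `y` ends
at the representative `M (y + e_μ)` of the neighbouring block. [folklore] -/
theorem pathEnd_torusBlockCorner_replicate (y : TorusSite d S) (μ : Fin d) :
    pathEnd (torusBlockCorner M S y) (List.replicate M μ) = torusBlockCorner M S (Site.shift y μ) := by
  rw [pathEnd_eq_add, List.map_replicate, List.sum_replicate]
  unfold Site.shift
  rw [torusBlockCorner_add, torusBlockCorner_single]
  congr 1
  funext i
  by_cases h : i = μ
  · subst h; simp
  · simp [h]

omit [NeZero S] in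
/-- Parallel transport in the trivial gauge field is trivial. [folklore] -/
@[simp] theorem transport_one {G : Type*} [Monoid G] (c : TorusSite d S) (is : List (Fin d)) :
    transport (1 : GaugeConfig d S G) c is = 1 := by
  induction is generalizing c with
  | nil => rfl
  | cons i is ih => rw [transport_cons, ih, Pi.one_apply, one_mul]

end Corner

/-! ### Admissible gauge-covariant block maps -/

/-- **A gauge-covariant block-averaging map of lattice QCD** from the torus of side `M · S` (fine) to
the torus of side `S` (coarse), blocks `B(y) = {x | ⌊x/M⌋ = y}` of `M⁴` fine sites represented by `M y`:
a blocked gauge field `link U` on the coarse links and covariant block-averaging matrices of the quark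
generators, `avg U = Q(U)` (coarse × fine: `ψ_B(y) = Σ_{x∈B(y)} Q(U)_{yx} ψ(x)`) and `avgBar U = Q̄(U)`
(fine × coarse: `ψ̄_B(y) = Σ_x ψ̄(x) Q̄(U)_{xy}`), such that the link map COMMUTES WITH LATTICE GAUGE
TRANSFORMATIONS `g ↦ g ∘ (y ↦ My)` and the quark averages are gauge COVARIANT
(`Q(U^g) = 𝒢'(g∘corner) Q(U) 𝒢(g)⁻¹`, `Q̄(U^g) = 𝒢(g) Q̄(U) 𝒢'(g∘corner)⁻¹`) and supported in the blocks.
Bałaban's renormalization transformation `(Tρ)(V) = ∫ dU δ(ŪV⁻¹) ρ(U)` is built on such an averaging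
`U ↦ Ū`, of which he says "we may take any averaging operation satisfying several general properties"
(CMP 119 (1988) p. 243); the quark averages are those of Bałaban–O'Carroll–Schor in Dimock's
gauge-covariant form. Hypercubic covariance and link locality are not fields (module docstring). The
canonical inhabitant is `GaugeCovariantBlockMap.central`. [cite: Balaban1988Convergent, p. 243 (0.1)] [cite: Dimock2022QED3, §2] [cite: BalabanOcarrollSchor1989, §I (1.1)] -/
structure GaugeCovariantBlockMap (M S : ℕ) [NeZero M] [NeZero S] where
  /-- the blocked gauge field on the coarse links -/
  link : GaugeConfig 4 (M * S) 𝔾 → GaugeConfig 4 S 𝔾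
  /-- the covariant block-averaging matrix `Q(U)` of the quark generators `ψ` (coarse × fine) -/
  avg : GaugeConfig 4 (M * S) 𝔾 → Matrix (QuarkPos S) (QuarkPos (M * S)) ℂ
  /-- the conjugate block-averaging matrix `Q̄(U)` of the generators `ψ̄` (fine × coarse) -/
  avgBar : GaugeConfig 4 (M * S) 𝔾 → Matrix (QuarkPos (M * S)) (QuarkPos S) ℂ
  /-- the link map commutes with gauge transformations `g ↦ g ∘ (y ↦ M y)` -/
  link_gaugeTransform : ∀ (g : TorusSite 4 (M * S) → 𝔾) (U : GaugeConfig 4 (M * S) 𝔾),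
    link (gaugeTransform g U) = gaugeTransform (g ∘ torusBlockCorner M S) (link U)
  /-- gauge covariance of `Q(U)` -/
  avg_gaugeTransform : ∀ (g : TorusSite 4 (M * S) → 𝔾) (U : GaugeConfig 4 (M * S) 𝔾),
    avg (gaugeTransform g U) =
      gaugeRotation (fundamentalRep (Fin 3)) (Fin 4) (g ∘ torusBlockCorner M S) * avg U *
        gaugeRotation (fundamentalRep (Fin 3)) (Fin 4) g⁻¹
  /-- gauge covariance of `Q̄(U)` -/
  avgBar_gaugeTransform : ∀ (g : TorusSite 4 (M * S) → 𝔾) (U : GaugeConfig 4 (M * S) 𝔾),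
    avgBar (gaugeTransform g U) =
      gaugeRotation (fundamentalRep (Fin 3)) (Fin 4) g * avgBar U *
        gaugeRotation (fundamentalRep (Fin 3)) (Fin 4) (g ∘ torusBlockCorner M S)⁻¹
  /-- `ψ_B(y)` involves only the `ψ(x)`, `x ∈ B(y)` -/
  avg_eq_zero : ∀ (U : GaugeConfig 4 (M * S) 𝔾) (p : QuarkPos S) (q : QuarkPos (M * S)),
    torusBlockOf M S q.1 ≠ p.1 → avg U p q = 0
  /-- `ψ̄_B(y)` involves only the `ψ̄(x)`, `x ∈ B(y)` -/
  avgBar_eq_zero : ∀ (U : GaugeConfig 4 (M * S) 𝔾) (q : QuarkPos (M * S)) (p : QuarkPos S),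
    torusBlockOf M S q.1 ≠ p.1 → avgBar U q p = 0

namespace GaugeCovariantBlockMap

variable {M S : ℕ} [NeZero M] [NeZero S] (B : GaugeCovariantBlockMap M S)

/-- **The quark pull-back of the block map in the background `U`**: the algebra homomorphism
`FermiAlg N_f S →ₐ FermiAlg N_f (M·S)` substituting the block averages for the coarse generators,
`ψ_{f}(y,a,α) ↦ Σ_x Q(U)_{(y,a,α),(x,b,β)} ψ_f(x,b,β)`, `ψ̄_f(y,·) ↦ Σ_x ψ̄_f(x,·) Q̄(U)_{x,y}` (BOS (1.1): the
coarse density is a function of `Qψ`, `ψ̄Q̄`). [cite: BalabanOcarrollSchor1989, §I (1.1)] [cite: Dimock2022QED3, §2] -/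
def quarkPullback (Nf : ℕ) (U : GaugeConfig 4 (M * S) 𝔾) : FermiAlg Nf S →ₐ[ℂ] FermiAlg Nf (M * S) :=
  quarkSubst (B.avg U) (B.avgBar U)

/-- **The pull-back `A ∘ B` of a coarse lattice QCD observable** along the block map: the fine
observable `U ↦ (quark pull-back in the background U) (A (link U))`. [cite: Balaban1988Convergent, p. 243 (0.1)] -/
def pullback {Nf : ℕ} (A : GaugeConfig 4 S 𝔾 → FermiAlg Nf S) :
    GaugeConfig 4 (M * S) 𝔾 → FermiAlg Nf (M * S) :=
  fun U => B.quarkPullback Nf U (A (B.link U))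

/-- **The push-forward functional `A ↦ ⟨A ∘ B⟩`**: the lattice QCD expectation (`qcdTorusExpect`, inverse
bare coupling `β`, bare masses `m_f`, torus of side `M·S`, signed fermion determinant) of the pull-back of
the coarse observable `A` — the image `B_*μ` of the fine functional, living on the coarse torus of side
`S` (Bałaban's `Tρ` read on expectations). [cite: Balaban1988Convergent, p. 243 (0.1)] -/
def expect {Nf : ℕ} (β : ℝ) (mq : Fin Nf → ℝ) (A : GaugeConfig 4 S 𝔾 → FermiAlg Nf S) : ℂ :=
  qcdTorusExpect β (M * S) mq (B.pullback A)

/-- Unfolding `pullback`. [folklore] -/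
theorem pullback_apply {Nf : ℕ} (A : GaugeConfig 4 S 𝔾 → FermiAlg Nf S) (U : GaugeConfig 4 (M * S) 𝔾) :
    B.pullback A U = B.quarkPullback Nf U (A (B.link U)) := rfl

/-- The pull-back is multiplicative in the observable (it is an algebra homomorphism pointwise). [folklore] -/
theorem pullback_mul {Nf : ℕ} (A A' : GaugeConfig 4 S 𝔾 → FermiAlg Nf S) :
    B.pullback (fun V => A V * A' V) = fun U => B.pullback A U * B.pullback A' U := by
  funext U; simp [pullback]

/-- The pull-back of a constant observable is the constant. [folklore] -/
theorem pullback_const {Nf : ℕ} (a : ℂ) :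
    B.pullback (fun _ : GaugeConfig 4 S 𝔾 => algebraMap ℂ (FermiAlg Nf S) a) =
      fun _ => algebraMap ℂ (FermiAlg Nf (M * S)) a := by
  funext U; simp [pullback]

/-- **Gauge covariance of the quark pull-back**: transforming the fine quark variables after pulling
back in the transformed background is pulling back after transforming the coarse variables with
`g' = g ∘ (y ↦ My)`: `𝒯(g) ∘ Φ_{U^g} = Φ_U ∘ 𝒯'(g ∘ corner)`. [cite: Dimock2022QED3, §2] -/
theorem torusQuarkGauge_comp_quarkPullback (Nf : ℕ) (g : TorusSite 4 (M * S) → 𝔾)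
    (U : GaugeConfig 4 (M * S) 𝔾) :
    (torusQuarkGauge g).comp (B.quarkPullback Nf (gaugeTransform g U)) =
      (B.quarkPullback Nf U).comp (torusQuarkGauge (g ∘ torusBlockCorner M S)) := by
  rw [torusQuarkGauge, torusQuarkGauge, quarkPullback, quarkPullback, quarkSubst_comp, quarkSubst_comp,
    B.avg_gaugeTransform, B.avgBar_gaugeTransform]
  congr 1
  · rw [Matrix.mul_assoc, gaugeRotation_mul, inv_mul_cancel, gaugeRotation_one, Matrix.mul_one]
  · rw [← Matrix.mul_assoc, ← Matrix.mul_assoc, gaugeRotation_mul, inv_mul_cancel, gaugeRotation_one,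
      Matrix.one_mul]

/-- **Gauge-invariant coarse observables pull back to gauge-invariant fine observables** — the reason
block maps must be covariant: `B_*μ` is then again a gauge-invariant functional and the blocked
effective action is gauge invariant (Bałaban CMP 119 (1988) p. 259 (iii)). [cite: Balaban1988Convergent, p. 243 (0.1)] [cite: Dimock2022QED3, §2] -/
theorem pullback_isQuarkGaugeInvariant {Nf : ℕ} {A : GaugeConfig 4 S 𝔾 → FermiAlg Nf S}
    (hA : IsQuarkGaugeInvariant A) : IsQuarkGaugeInvariant (B.pullback A) := by
  intro g U
  have h := congrArg (fun φ : FermiAlg Nf S →ₐ[ℂ] FermiAlg Nf (M * S) => φ (A (B.link (gaugeTransform g U))))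
    (B.torusQuarkGauge_comp_quarkPullback Nf g U)
  simp only [AlgHom.coe_comp, Function.comp_apply] at h
  rw [pullback_apply, pullback_apply, h, B.link_gaugeTransform, hA]

/-! #### The canonical block map: straight transporters and BOS–Dimock quark averages -/

variable (M S) in
/-- **The canonical gauge-covariant block map** with block factor `M`: the coarse link `(y, μ)` carries
the parallel transporter `U(My, μ) U(My + e_μ, μ) ⋯ U(My + (M-1)e_μ, μ)` along the straight line from
the representative `My` of `B(y)` to the representative of `B(y + e_μ)` (Bałaban's block link variable in
the block axial gauge, CMP 95 (1984) (1.4)–(1.6), as in the tree's `axialBlockHolonomy`; the central term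
of his non-linear average), and the quark generators are averaged by the Bałaban–O'Carroll–Schor /
Dimock covariant block averages `Q(U)_{(y,a,α),(x,b,β)} = M⁻⁴ [x ∈ B(y)] ρ(U(Γ_{My,x}))_{ab} δ_{αβ}`,
`Q̄(U)` with the inverse transporters (tree `fermionBlockAvg`, `fermionBlockAvgBar`, transport along the
fixed coordinate-ordered path `Γ_{My,x}` inside the block). [cite: Dimock2022QED3, §2] [cite: BalabanOcarrollSchor1989, §I (1.1)] [cite: Balaban1984Propagators, §1 (1.4)–(1.7)] -/
def central : GaugeCovariantBlockMap M S where
  link U e := transport U (torusBlockCorner M S e.1) (List.replicate M e.2)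
  avg U := fermionBlockAvg M S (fundamentalRep (Fin 3)) (Fin 4) U
  avgBar U := fermionBlockAvgBar M S (fundamentalRep (Fin 3)) (Fin 4) U
  link_gaugeTransform g U := by
    funext e
    change transport (gaugeTransform g U) _ _ =
      g (torusBlockCorner M S e.1) * transport U (torusBlockCorner M S e.1) (List.replicate M e.2) *
        (g (torusBlockCorner M S (Site.shift e.1 e.2)))⁻¹
    rw [transport_gaugeTransform, pathEnd_torusBlockCorner_replicate]
  avg_gaugeTransform g U := fermionBlockAvg_gaugeTransform _ g U
  avgBar_gaugeTransform g U := fermionBlockAvgBar_gaugeTransform _ g U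
  avg_eq_zero U p q h := by simp [fermionBlockAvg, h]
  avgBar_eq_zero U q p h := by simp [fermionBlockAvgBar, h]

/-- The blocked link of `central` is the straight transporter between block representatives. [folklore] -/
@[simp] theorem central_link (U : GaugeConfig 4 (M * S) 𝔾) (e : Edge 4 S) :
    (central M S).link U e = transport U (torusBlockCorner M S e.1) (List.replicate M e.2) := rfl

/-- The quark average of `central` is the tree's `fermionBlockAvg`. [folklore] -/
@[simp] theorem central_avg (U : GaugeConfig 4 (M * S) 𝔾) :
    (central M S).avg U = fermionBlockAvg M S (fundamentalRep (Fin 3)) (Fin 4) U := rfl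

/-- The conjugate quark average of `central` is the tree's `fermionBlockAvgBar`. [folklore] -/
@[simp] theorem central_avgBar (U : GaugeConfig 4 (M * S) 𝔾) :
    (central M S).avgBar U = fermionBlockAvgBar M S (fundamentalRep (Fin 3)) (Fin 4) U := rfl

/-- With block factor `M = 1` the canonical link map is the identity (every site is its own block). [folklore] -/
theorem central_link_one (U : GaugeConfig 4 (1 * S) 𝔾) (e : Edge 4 S) :
    (central 1 S).link U e = U (torusBlockCorner 1 S e.1, e.2) := by
  simp [List.replicate]

/-- The canonical block map sends the trivial fine gauge field to the trivial coarse gauge field. [folklore] -/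
@[simp] theorem central_link_const_one : (central M S).link 1 = 1 := by
  funext e
  exact transport_one (G := 𝔾) (M * S) _ _

/-- Pulling back along the canonical block map in the trivial background is the plain arithmetic
block average of the quark generators: `ψ_f(y,a,α) ↦ M⁻⁴ Σ_{x ∈ B(y)} ψ_f(x,a,α)`. [cite: BalabanOcarrollSchor1989, §I (1.1)] -/
theorem central_quarkPullback_one_q (Nf : ℕ) (f : Fin Nf) (p : QuarkPos S) :
    (central M S).quarkPullback Nf 1 (q (f, p)) =
      ∑ r : QuarkPos (M * S), (if torusBlockOf M S r.1 = p.1 ∧ p.2 = r.2 then ((M : ℂ) ^ 4)⁻¹ else 0) •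
        q (f, r) := by
  rw [quarkPullback, quarkSubst_q]
  refine Finset.sum_congr rfl fun r _ => ?_
  congr 1
  simp only [central_avg, fermionBlockAvg, Matrix.of_apply, blockTransporter, transport_one, map_one,
    Matrix.one_apply, Prod.ext_iff]
  by_cases h1 : torusBlockOf M S r.1 = p.1 <;> by_cases h2 : p.2.1 = r.2.1 <;> by_cases h3 : p.2.2 = r.2.2 <;>
    simp [h1, h2, h3]

end GaugeCovariantBlockMap

/-! ### Ladders of schemes and blocked lattice `n`-point functions -/

variable {Nf : ℕ}

/-- The renormalised smeared species-`s` field of step `k` **on the torus of side `2S'+1`** (any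
`S' ≥ L_k`): `Φ_k^s(f) = z_s(k) a_k⁴ Σ_{x ∈ {-S',…,S'}⁴} f(a_k x) (O_s(x) - shift_s(k))`, the formula of
`QCDOS.smearedInsertion` with the box of the larger torus (`smearedInsertionOn_self`). [cite: MontvayMunster1994, §5.1] -/
def smearedInsertionOn (sch : QCDScheme Nf) (k S' : ℕ) (U : GaugeConfig 4 (2 * S' + 1) 𝔾)
    (s : QCDField Nf) (f : 𝓢(EuclideanSpace ℝ (Fin 4), ℝ)) : FermiAlg Nf (2 * S' + 1) :=
  ∑ x ∈ box 4 S', ((sch.z s k * sch.a k ^ 4 * f (sch.a k • siteToE x) : ℝ) : ℂ) •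
    (insertion U s x - algebraMap ℂ _ ((sch.shift s k : ℝ) : ℂ))

/-- On the scheme's own torus (`S' = L_k`) this is `smearedInsertion`. [folklore] -/
theorem smearedInsertionOn_self (sch : QCDScheme Nf) (k : ℕ) :
    smearedInsertionOn sch k (sch.L k) = smearedInsertion sch k := rfl

/-- **The scheme is an `M`-adic block ladder**: the spacings are exactly `M`-adic, `a_k = M · a_{k+1}`,
so that the step-`(k+1)` lattice is the `M`-fold refinement of the step-`k` lattice and one RG octave is
ONE block map of factor `M` at equal physical size (the route's "nested 3-adic ladder",
`a_{k+1} = a_k/3`; Bałaban's and Gawędzki–Kupiainen's sequences of `L^{-k}`-lattices). The TORI of the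
scheme are not required to be nested: `side (k+1) = M · side k` would keep the physical volume
`a_k · side k` constant, which `QCDScheme.tendsto_L` (`a_k L_k → ∞`) forbids; one-octave comparisons are
made on a common torus instead (`blockedLatticeSchwinger`, `latticeSchwingerOn` below, any coarse side
`2S'+1 ≥ side k`), using the volume-uniformity of the scheme's clauses. [cite: Balaban1988Convergent, p. 244] [cite: GawedzkiKupiainenMasslessLattice1985] -/
def QCDScheme.IsBlockLadder (M : ℕ) (sch : QCDScheme Nf) : Prop :=
  ∀ k, sch.a k = M * sch.a (k + 1)

/-- On a block ladder the spacings are `a_k = a_0 / M^k`. [folklore] -/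
theorem QCDScheme.IsBlockLadder.a_eq {M : ℕ} [NeZero M] {sch : QCDScheme Nf} (h : sch.IsBlockLadder M)
    (k : ℕ) : sch.a k = sch.a 0 / (M : ℝ) ^ k := by
  induction k with
  | zero => simp
  | succ k ih =>
    have hM : (M : ℝ) ≠ 0 := Nat.cast_ne_zero.2 (NeZero.ne M)
    rw [pow_succ, ← div_div, ← ih, h k, mul_div_cancel_left₀ _ hM]

/-- A block ladder has a genuine block factor, `1 < M` (`M = 0` contradicts `a_0 > 0`; `M = 1` makes
`a` constant, contradicting `a_k → 0 < a_0`). [folklore] -/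
theorem QCDScheme.IsBlockLadder.one_lt {M : ℕ} {sch : QCDScheme Nf} (h : sch.IsBlockLadder M) : 1 < M := by
  by_contra hM
  push Not at hM
  interval_cases M
  · have := h 0
    simp only [Nat.cast_zero, zero_mul] at this
    exact (sch.a_pos 0).ne' this
  · -- `a` is constant, contradicting `a_k → 0 < a_0`
    have hconst : ∀ k, sch.a k = sch.a 0 := by
      intro k
      induction k with
      | zero => rfl
      | succ k ih => have := h k; simp only [Nat.cast_one, one_mul] at this; rw [← this, ih]
    have ha : sch.a = fun _ => sch.a 0 := funext hconst
    have ht : Tendsto (fun _ : ℕ => sch.a 0) atTop (𝓝 0) := ha ▸ sch.tendsto_a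
    exact (sch.a_pos 0).ne' (tendsto_nhds_unique tendsto_const_nhds ht)

variable (Nf) in
/-- The degenerate **triadic scheme** `a_k = 3^{-k}`, `L_k = 9^k` (`a_k L_k = 3^k → ∞`), all couplings and
renormalisations `0`: non-vacuity of `IsBlockLadder 3`. [folklore] -/
def QCDScheme.triadic : QCDScheme Nf where
  a := fun k => (1 / 3 : ℝ) ^ k
  a_pos := fun k => by positivity
  tendsto_a := tendsto_pow_atTop_nhds_zero_of_lt_one (by norm_num) (by norm_num)
  β := fun _ => 0
  L := fun k => 9 ^ k
  tendsto_L := by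
    have h3 : Tendsto (fun k : ℕ => (3 : ℝ) ^ k) atTop atTop := tendsto_pow_atTop_atTop_of_one_lt (by norm_num)
    refine h3.congr fun k => ?_
    rw [Nat.cast_pow, ← mul_pow]
    norm_num
  mq := fun _ _ => 0
  z := fun _ _ => 0
  shift := fun _ _ => 0

/-- The triadic scheme is a `3`-adic block ladder. [folklore] -/
theorem QCDScheme.isBlockLadder_triadic : (QCDScheme.triadic Nf).IsBlockLadder 3 := by
  intro k
  simp only [QCDScheme.triadic, pow_succ]
  ring

/-- The step-`k` lattice `n`-point function of the scheme **on the torus of side `2S'+1`** (any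
`S' ≥ L_k`): `⟨∏ᵢ Φ_k^{σᵢ}(fᵢ)⟩` under `qcdTorusExpect` at `β_k`, `m_f(k)`, the smeared fields summed over the
box of that torus (`smearedInsertionOn`); at `S' = L_k` it is `qcdLatticeSchwinger sch k`
(`latticeSchwingerOn_self`). The volume-uniform form in which the scheme's functional is compared with
its blocked successor. [cite: MontvayMunster1994, §5.1] -/
def latticeSchwingerOn (sch : QCDScheme Nf) (k S' n : ℕ) (σ : Fin n → QCDField Nf)
    (f : Fin n → 𝓢(EuclideanSpace ℝ (Fin 4), ℝ)) : ℂ :=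
  qcdTorusExpect (sch.β k) (2 * S' + 1) (fun fl => sch.mq fl k)
    fun U => (List.ofFn fun i => smearedInsertionOn sch k S' U (σ i) (f i)).prod

/-- On the scheme's own torus `latticeSchwingerOn` is `qcdLatticeSchwinger` (definitional bookkeeping
between `QCDOS.qcdLatticeSchwinger` and `QCDOS.qcdTorusExpect`). [folklore] -/
theorem latticeSchwingerOn_self (sch : QCDScheme Nf) (k n : ℕ) (σ : Fin n → QCDField Nf)
    (f : Fin n → 𝓢(EuclideanSpace ℝ (Fin 4), ℝ)) :
    latticeSchwingerOn sch k (sch.L k) n σ f = qcdLatticeSchwinger sch k n σ f :=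
  rfl

/-- **Blocked lattice `n`-point function** `⟨(∏ᵢ Φ_k^{σᵢ}(fᵢ)) ∘ B⟩_{k+1}` on the common torus: the product
of the step-`k` renormalised smeared species fields on the coarse torus of side `2S'+1` (an observable of
the coarse lattice, `smearedInsertionOn sch k S'`) pulled back along the block map `B` and integrated
against the lattice QCD functional with the couplings `β_{k+1}`, `m_f(k+1)` of step `k+1` on the fine torus
of side `M(2S'+1)` (spacing `a_{k+1} = a_k/M` on a block ladder). Its difference with
`latticeSchwingerOn sch k S' n σ f` is the route's ONE-OCTAVE INCREMENT at step `k` in the volume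
`(2S'+1) a_k`, up to the blocked-vs-fine species mismatch. [cite: Balaban1988Convergent, p. 243 (0.1)] -/
def blockedLatticeSchwinger (sch : QCDScheme Nf) {M : ℕ} [NeZero M] (k S' : ℕ)
    (B : GaugeCovariantBlockMap M (2 * S' + 1)) (n : ℕ) (σ : Fin n → QCDField Nf)
    (f : Fin n → 𝓢(EuclideanSpace ℝ (Fin 4), ℝ)) : ℂ :=
  B.expect (sch.β (k + 1)) (fun fl => sch.mq fl (k + 1))
    fun V => (List.ofFn fun i => smearedInsertionOn sch k S' V (σ i) (f i)).prod

/-! ### Bounded renormalised insertions -/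

/-- **Truncated insertion of a local density into a smeared correlator** on the torus of side `2S'+1` at
the step-`k` couplings `β_k`, `m_f(k)`:
`⟨Φ_k^{σ₁}(f₁) ⋯ Φ_k^{σₙ}(fₙ) ; O(x)⟩_conn = ⟨(∏ᵢ Φᵢ) · O(x)⟩ - ⟨∏ᵢ Φᵢ⟩ ⟨O(x)⟩`, `O` a gauge-invariant local
lattice QCD observable placed at `x` (`QCDLatticeObservable.onTorus`). [cite: GlimmJaffe1987, §6.1 (truncated functions)] -/
def insertionCorr (sch : QCDScheme Nf) (k S' n : ℕ) (σ : Fin n → QCDField Nf)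
    (f : Fin n → 𝓢(EuclideanSpace ℝ (Fin 4), ℝ)) {R : ℕ} (O : QCDLatticeObservable Nf R)
    (x : _root_.Literature.Probability.LatticeModels.Site 4) : ℂ :=
  qcdTorusExpect (sch.β k) (2 * S' + 1) (fun fl => sch.mq fl k)
      (fun U => (List.ofFn fun i => smearedInsertionOn sch k S' U (σ i) (f i)).prod *
        O.onTorus (2 * S' + 1) x U) -
    qcdTorusExpect (sch.β k) (2 * S' + 1) (fun fl => sch.mq fl k)
        (fun U => (List.ofFn fun i => smearedInsertionOn sch k S' U (σ i) (f i)).prod) *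
      qcdTorusExpect (sch.β k) (2 * S' + 1) (fun fl => sch.mq fl k) (O.onTorus (2 * S' + 1) x)

/-- **Pairwise separated supports**: any two of the test functions have (topological) supports at a
positive distance — the off-diagonal regime in which truncated insertions are finite and contact terms
are never tested. [folklore] -/
def AreSupportSeparated {n : ℕ} (f : Fin n → 𝓢(EuclideanSpace ℝ (Fin 4), ℝ)) : Prop :=
  ∀ i j, i ≠ j → ∃ η : ℝ, 0 < η ∧ ∀ y ∈ tsupport (f i), ∀ y' ∈ tsupport (f j), η ≤ dist y y'

/-- Separated supports are disjoint. [folklore] -/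
theorem AreSupportSeparated.disjoint {n : ℕ} {f : Fin n → 𝓢(EuclideanSpace ℝ (Fin 4), ℝ)}
    (h : AreSupportSeparated f) {i j : Fin n} (hij : i ≠ j) :
    Disjoint (tsupport (f i)) (tsupport (f j)) := by
  obtain ⟨η, hη, hsep⟩ := h i j hij
  refine Set.disjoint_left.2 fun y hy hy' => ?_
  have := hsep y hy y hy'
  rw [dist_self] at this
  linarith

/-- The empty and one-element families are separated. [folklore] -/
theorem areSupportSeparated_of_subsingleton {n : ℕ} [Subsingleton (Fin n)]
    (f : Fin n → 𝓢(EuclideanSpace ℝ (Fin 4), ℝ)) : AreSupportSeparated f :=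
  fun i j hij => absurd (Subsingleton.elim i j) hij

/-- **Bounded renormalised insertions of dimension `d`** for the family `m ↦ reg.scheme m (z m) (shift m)`
of lattice QCD functionals and the family `O k` of gauge-invariant local lattice densities (dimensionless,
of canonical dimension `d`: `O_k(x) ≈ a_k^d O^{phys}(a_k x)` at tree level): for every `n`, species string
`σ`, real test functions `fᵢ` with pairwise separated supports, every compact set `K` of positive mass
tuples and every `δ > 0` there is ONE constant `C` such that for all steps `k`, all `m ∈ K`, all tori of
side `2S'+1 ≥ 2L_k+1` and all lattice points `x` of the box at physical distance `≥ δ` from every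
`supp fᵢ`, `‖⟨Φ_k^{σ₁}(f₁) ⋯ Φ_k^{σₙ}(fₙ) ; O_k(x)⟩_conn‖ ≤ C · a_k^d` for all sufficiently large `k` (one
threshold for all `m ∈ K`, tori and points — the `∃ C, ∀ᶠ k` shape of `QCDScheme.HasLatticeMassGap`, the
clause such bounds are to be bought from; only tails in `k` matter for the continuum limit) — the
tree-level dimension factor explicit, the constant uniform in the cutoff, the volume and locally in the
masses. This is the shape in which Symanzik's local effective Lagrangian enters the route: a remainder
`Σ_x O_k(x)` of dimension `6` (gluonic) or `5` (Wilson quarks) in the blocked action has response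
`O(a_k²)`, `O(a_k)` in physical correlators (Montvay–Münster §5.3: coefficients of higher-dimension
operators carry positive powers of `a`). NOT asserted for honest lattice QCD (that is the crux). [cite: Symanzik1983] [cite: MontvayMunster1994, §5.3 (5.218)–(5.219)] -/
def IsBoundedInsertion (dO : ℕ) (reg : QCDRegularisation Nf)
    (z shift : (Fin Nf → ℝ) → QCDField Nf → ℕ → ℝ) {R : ℕ} (O : ℕ → QCDLatticeObservable Nf R) : Prop :=
  ∀ (n : ℕ) (σ : Fin n → QCDField Nf) (f : Fin n → 𝓢(EuclideanSpace ℝ (Fin 4), ℝ)),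
    AreSupportSeparated f → ∀ (K : Set (Fin Nf → ℝ)), IsCompact K → K ⊆ {m | ∀ fl, 0 < m fl} →
      ∀ (δ : ℝ), 0 < δ → ∃ C : ℝ, ∀ᶠ k : ℕ in atTop, ∀ m ∈ K, ∀ (S' : ℕ), reg.L k ≤ S' →
        ∀ x ∈ box 4 S',
          (∀ i, ∀ y ∈ tsupport (f i), δ ≤ dist (reg.a k • siteToE x) y) →
            ‖insertionCorr (reg.scheme m (z m) (shift m)) k S' n σ f (O k) x‖ ≤ C * reg.a k ^ dO

/-- Bounded insertions for a calibrated family: `IsBoundedInsertion d reg 𝒞.z 𝒞.shift O`. [folklore] -/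
abbrev CalibratedSpeciesFamily.IsBoundedInsertion {reg : QCDRegularisation Nf}
    (𝒞 : CalibratedSpeciesFamily reg) (dO : ℕ) {R : ℕ} (O : ℕ → QCDLatticeObservable Nf R) : Prop :=
  QuantumFieldTheory.IsBoundedInsertion dO reg 𝒞.z 𝒞.shift O

/-- The unit observable placed anywhere on any torus is `1`. [folklore] -/
@[simp] theorem QCDLatticeObservable.one_onTorus (R S : ℕ) [NeZero S]
    (v : _root_.Literature.Probability.LatticeModels.Site 4) (U : GaugeConfig 4 S 𝔾) :
    (QCDLatticeObservable.one Nf R).onTorus S v U = 1 :=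
  map_one _

/-- **The unit density has vanishing truncated insertions**: `⟨∏Φ ; 1⟩_conn = ⟨∏Φ⟩ - ⟨∏Φ⟩⟨1⟩ = 0`
(also on the junk branch of a vanishing partition function, where all expectations are `0`). [folklore] -/
theorem insertionCorr_one (sch : QCDScheme Nf) (k S' n : ℕ) (σ : Fin n → QCDField Nf)
    (f : Fin n → 𝓢(EuclideanSpace ℝ (Fin 4), ℝ)) (R : ℕ)
    (x : _root_.Literature.Probability.LatticeModels.Site 4) :
    insertionCorr sch k S' n σ f (QCDLatticeObservable.one Nf R) x = 0 := by
  unfold insertionCorr qcdTorusExpect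
  simp only [QCDLatticeObservable.one_onTorus, mul_one, one_mul]
  by_cases hZ : (∫ U, fermiIntegral (fermiBoltzmann U fun fl => sch.mq fl k)
      ∂(wilsonMeasure (d := 4) (L := 2 * S' + 1) (fundamentalRep (Fin 3)) (sch.β k))) = 0
  · simp [hZ]
  · rw [div_self hZ, mul_one, sub_self]

/-- **Non-vacuity**: the constant family of unit densities has bounded insertions of every dimension
(with constant `0`). The content of the predicate is in honest composite densities. [folklore] -/
theorem isBoundedInsertion_one (dO : ℕ) (reg : QCDRegularisation Nf)
    (z shift : (Fin Nf → ℝ) → QCDField Nf → ℕ → ℝ) (R : ℕ) :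
    IsBoundedInsertion dO reg z shift fun _ => QCDLatticeObservable.one Nf R := by
  intro n σ f _ K _ _ δ _
  refine ⟨0, Eventually.of_forall fun k m _ S' _ x _ _ => ?_⟩
  rw [insertionCorr_one, norm_zero, zero_mul]

/-- The bound may be taken with a non-negative constant. [folklore] -/
theorem IsBoundedInsertion.exists_nonneg {dO : ℕ} {reg : QCDRegularisation Nf}
    {z shift : (Fin Nf → ℝ) → QCDField Nf → ℕ → ℝ} {R : ℕ} {O : ℕ → QCDLatticeObservable Nf R}
    (h : IsBoundedInsertion dO reg z shift O) {n : ℕ} (σ : Fin n → QCDField Nf)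
    {f : Fin n → 𝓢(EuclideanSpace ℝ (Fin 4), ℝ)} (hf : AreSupportSeparated f) {K : Set (Fin Nf → ℝ)}
    (hK : IsCompact K) (hpos : K ⊆ {m | ∀ fl, 0 < m fl}) {δ : ℝ} (hδ : 0 < δ) :
    ∃ C : ℝ, 0 ≤ C ∧ ∀ᶠ k : ℕ in atTop, ∀ m ∈ K, ∀ (S' : ℕ), reg.L k ≤ S' → ∀ x ∈ box 4 S',
      (∀ i, ∀ y ∈ tsupport (f i), δ ≤ dist (reg.a k • siteToE x) y) →
        ‖insertionCorr (reg.scheme m (z m) (shift m)) k S' n σ f (O k) x‖ ≤ C * reg.a k ^ dO := by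
  obtain ⟨C, hC⟩ := h n σ f hf K hK hpos δ hδ
  refine ⟨max C 0, le_max_right _ _, ?_⟩
  filter_upwards [hC] with k hk m hm S' hS x hx hfar
  exact (hk m hm S' hS x hx hfar).trans
    (mul_le_mul_of_nonneg_right (le_max_left _ _) (pow_nonneg (reg.a_pos k).le _))

end Literature.MathematicalPhysics.QuantumFieldTheory

end
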